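import Summits.Ventures.DiscreteObjects.UnitDistance.LineCayleyHoffman
import HarnessLib

/-!
# `α(UD(F₂₇²)) ≤ 162` again — as an instance of the Hoffman bound for Cayley graphs of lines (`LineCayleyHoffman.lean`)

Framing (verbatim for the cell): lottery ticket; floor = certified bounds/negative ranges.

`UnitQuadranceF27Hoffman.lean` (udg g7) proved `α(unitCircleGraph F) ≤ 162` for the fields with 27 elements from a 308-entry
weighted certificate checked by `729 × 308` dot products.  Here the same number falls out of the GENERAL theorem
`indepNum_bound_of_lines` with the data `p = 3`, `n = 6`, `D` = the 28 unit-circle vectors (`|D| = 28`), `m = 4`: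

  `α · (28 − 4) · 3 ≤ 3⁶ · (28 − 3·4)`, i.e. `72 α ≤ 11664`, `α ≤ 162`,

and the only instance-specific kernel facts are SMALL and structural: (i) every non-zero functional on `F₃⁶` vanishes on at least
4 of the 28 circle vectors (`729 × 28` dot products; the minimum 4 = twice the minimum number 2 of circle directions in a hyperplane,
TABLE-U6 §1), (ii) a non-zero vector off the circle is not a multiple of a circle vector and vice versa (`729 × 28 × 3` comparisons).
This is a second, independent kernel route to the `q = 27` Hoffman value (two implementations of one bound, census discipline),
and the template for the other `3`-power residue fields (`q = 243`: `Cay(F₃¹⁰, 122 lines)`).  Seat udg g8 (zero farm).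
-/

namespace Summit.Ventures.DiscreteObjects.UnitDistance

open SimpleGraph Finset F27

/-! ## 1. Coordinates `F27 × F27 = F₃⁶` -/

/-- The six `F₃`-coordinates `(a₁,b₁,c₁,a₂,b₂,c₂)` of a point of `F27 × F27`. -/
def coordV (x : F27 × F27) : Fin 6 → ZMod 3 := ![x.1.a, x.1.b, x.1.c, x.2.a, x.2.b, x.2.c]

/-- Inverse coordinate map. -/
def ofCoordV (v : Fin 6 → ZMod 3) : F27 × F27 := (⟨v 0, v 1, v 2⟩, ⟨v 3, v 4, v 5⟩)

/-- `ofCoordV ∘ coordV = id`. -/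
theorem ofCoordV_coordV (x : F27 × F27) : ofCoordV (coordV x) = x := by
  obtain ⟨⟨a, b, c⟩, ⟨d, e, f⟩⟩ := x
  rfl

/-- `coordV ∘ ofCoordV = id`. -/
theorem coordV_ofCoordV (v : Fin 6 → ZMod 3) : coordV (ofCoordV v) = v := by
  ext i
  fin_cases i <;> rfl

/-- `coordV` is injective. -/
theorem coordV_injective : Function.Injective coordV := fun x y h => by
  rw [← ofCoordV_coordV x, h, ofCoordV_coordV]

/-- `ofCoordV` is injective. -/
theorem ofCoordV_injective : Function.Injective ofCoordV := fun x y h => by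
  rw [← coordV_ofCoordV x, h, coordV_ofCoordV]

/-- `coordV` is additive: `coordV (x − y) = coordV x − coordV y`. -/
theorem coordV_sub (x y : F27 × F27) : coordV (x - y) = coordV x - coordV y := by
  ext i
  fin_cases i <;> simp [coordV, F27.add_def, F27.neg_def, sub_eq_add_neg]

/-- `coordV 0 = 0`. -/
theorem coordV_zero : coordV 0 = 0 := by
  ext i
  fin_cases i <;> rfl

/-- Raw scalar multiplication by `c ∈ F₃` on `F27 × F27` (componentwise on the six coordinates). -/
def smulV (c : ZMod 3) (x : F27 × F27) : F27 × F27 :=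
  (⟨c * x.1.a, c * x.1.b, c * x.1.c⟩, ⟨c * x.2.a, c * x.2.b, c * x.2.c⟩)

/-- `coordV (smulV c x) = c • coordV x`. -/
theorem coordV_smulV (c : ZMod 3) (x : F27 × F27) : coordV (smulV c x) = c • coordV x := by
  ext i
  fin_cases i <;> simp [coordV, smulV]

/-- The dot product in coordinates is `dotV` of `UnitQuadranceF27Hoffman.lean`. -/
theorem coordV_dotProduct (a t : F27 × F27) : coordV a ⬝ᵥ coordV t = dotV a t := by
  simp only [dotProduct, Fin.sum_univ_succ, Fin.sum_univ_zero, coordV, dotV, Matrix.cons_val_zero, Matrix.cons_val_succ]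
  simp
  ring

/-! ## 2. The 28 circle vectors as directions and the two structural kernel facts -/

/-- The 28 unit-circle vectors of `F₂₇²`, in coordinates. -/
def circleDirs : Finset (Fin 6 → ZMod 3) := (udF27Circle.toFinset).image coordV

/-- The list of circle points has no duplicates. -/
theorem udF27Circle_nodup : udF27Circle.Nodup := by
  decide

/-- `|circleDirs| = 28`. -/
theorem card_circleDirs : #circleDirs = 28 := by
  rw [circleDirs, Finset.card_image_of_injective _ coordV_injective, List.toFinset_card_of_nodup udF27Circle_nodup]
  rfl

/-- KERNEL FACT (i): every non-zero functional on `F₃⁶` vanishes on at least 4 of the 28 circle vectors (`729 × 28` dot products). -/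
theorem four_le_card_filter_dotV : ∀ a : F27 × F27, a ≠ 0 → 4 ≤ #(udF27Circle.toFinset.filter fun s => dotV a s = 0) := by
  decide +kernel

/-- Boolean check behind KERNEL FACT (ii), at one difference vector `t`: `t = 0`, or `t` is on the circle, or `t` is not an
`F₃`-multiple of a circle vector and no circle vector is a multiple of `t`. -/
def offCircleCheck (t : F27 × F27) : Bool :=
  decide (t = 0) || decide (quadRaw t = ⟨1, 0, 0⟩) ||
    udF27Circle.all fun s => ([0, 1, 2] : List (ZMod 3)).all fun c => decide (smulV c s ≠ t) && decide (smulV c t ≠ s)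

/-- KERNEL FACT (ii): the check passes at all 729 vectors (`729 × 28 × 3` comparisons each way). -/
theorem offCircleCheck_eq_true : ∀ t : F27 × F27, offCircleCheck t = true := by
  decide +kernel

/-- KERNEL FACT (ii) unpacked: a non-zero vector off the unit circle is not an `F₃`-multiple of a circle vector, nor conversely. -/
theorem off_circle_generic (t : F27 × F27) (ht : t ≠ 0) (hq : quadRaw t ≠ ⟨1, 0, 0⟩) {s : F27 × F27}
    (hs : s ∈ udF27Circle) (c : ZMod 3) : smulV c s ≠ t ∧ smulV c t ≠ s := by
  have h := offCircleCheck_eq_true t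
  simp only [offCircleCheck, Bool.or_eq_true, decide_eq_true_eq, List.all_eq_true, Bool.and_eq_true] at h
  rcases h with (h | h) | h
  · exact absurd h ht
  · exact absurd h hq
  · have hc : c ∈ ([0, 1, 2] : List (ZMod 3)) := by
      fin_cases c <;> decide
    exact h s hs c hc

/-- No circle vector is zero. -/
theorem udF27Circle_ne_zero : ∀ s ∈ udF27Circle, s ≠ 0 := by
  decide +kernel

/-- Membership in `circleDirs`. -/
theorem mem_circleDirs_iff {d : Fin 6 → ZMod 3} : d ∈ circleDirs ↔ ∃ s ∈ udF27Circle, coordV s = d := by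
  simp [circleDirs, List.mem_toFinset]

/-! ## 3. The hypotheses of `indepNum_bound_of_lines` for the coordinate model of `UD(F₂₇²)` -/

/-- The unit-quadrance graph of `F₂₇²` transported to `F₃⁶`. -/
def udF27Graph6 : SimpleGraph (Fin 6 → ZMod 3) := (unitCircleGraph F27).comap ofCoordV

/-- Directions are non-zero. -/
theorem circleDirs_ne_zero : ∀ d ∈ circleDirs, d ≠ 0 := by
  intro d hd
  obtain ⟨s, hs, rfl⟩ := mem_circleDirs_iff.mp hd
  rw [← coordV_zero]
  exact fun h => udF27Circle_ne_zero s hs (coordV_injective h)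

/-- Every non-zero functional kills at least `m = 4` directions. -/
theorem four_le_killCount (a : Fin 6 → ZMod 3) (ha : a ≠ 0) : 4 ≤ killCount circleDirs a := by
  have hb : ofCoordV a ≠ 0 := by
    intro h
    apply ha
    rw [← coordV_ofCoordV a, h, coordV_zero]
  have key := four_le_card_filter_dotV (ofCoordV a) hb
  unfold killCount circleDirs
  rw [Finset.filter_image, Finset.card_image_of_injective _ coordV_injective]
  refine le_trans key (le_of_eq ?_)
  congr 1
  refine Finset.filter_congr fun s _ => ?_
  rw [← coordV_dotProduct, coordV_ofCoordV]

/-- Distinct non-adjacent vertices differ by a vector on no circle line. -/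
theorem udF27Graph6_generic : ∀ x y : Fin 6 → ZMod 3, x ≠ y → ¬ udF27Graph6.Adj x y →
    ∀ d ∈ circleDirs, (∀ c : ZMod 3, c • d ≠ x - y) ∧ (∀ c : ZMod 3, c • (x - y) ≠ d) := by
  intro x y hxy hadj d hd
  obtain ⟨s, hs, rfl⟩ := mem_circleDirs_iff.mp hd
  set t : F27 × F27 := ofCoordV x - ofCoordV y with ht
  have hxy' : ofCoordV x ≠ ofCoordV y := fun h => hxy (ofCoordV_injective h)
  have ht0 : t ≠ 0 := sub_ne_zero.mpr hxy'
  have hct : coordV t = x - y := by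
    rw [ht, coordV_sub, coordV_ofCoordV, coordV_ofCoordV]
  have hq : quadRaw t ≠ ⟨1, 0, 0⟩ := by
    intro h
    apply hadj
    refine ⟨hxy', ?_⟩
    have h' : t.1 ^ 2 + t.2 ^ 2 = 1 := by rw [← quadRaw_eq, h]; rfl
    simpa only [ht, Prod.fst_sub, Prod.snd_sub] using h'
  refine ⟨fun c hc => (off_circle_generic t ht0 hq hs c).1 (coordV_injective ?_),
    fun c hc => (off_circle_generic t ht0 hq hs c).2 (coordV_injective ?_)⟩
  · rw [coordV_smulV, hc, hct]
  · rw [coordV_smulV, hct, hc]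

/-! ## 4. `α ≤ 162` from the general theorem, and transfer -/

/-- `α(udF27Graph6) ≤ 162`: the Hoffman bound for Cayley graphs of lines with `|D| = 28`, `m = 4`: `72·α ≤ 11664`. -/
theorem indepNum_udF27Graph6_le : udF27Graph6.indepNum ≤ 162 := by
  have h := indepNum_bound_of_lines circleDirs circleDirs_ne_zero 4 four_le_killCount udF27Graph6_generic
  rw [card_circleDirs] at h
  push_cast at h
  omega

/-- Independent sets of `unitCircleGraph F27` map to independent sets of the coordinate model. -/
theorem isIndepSet_udF27Graph6_map {A : Finset (F27 × F27)} (hA : (unitCircleGraph F27).IsIndepSet (A : Set (F27 × F27))) :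
    udF27Graph6.IsIndepSet ((A.map ⟨coordV, coordV_injective⟩ : Finset (Fin 6 → ZMod 3)) : Set (Fin 6 → ZMod 3)) := by
  intro x hx y hy hxy hadj
  rw [Finset.coe_map, Set.mem_image] at hx hy
  obtain ⟨x', hx', rfl⟩ := hx
  obtain ⟨y', hy', rfl⟩ := hy
  have hadj' : (unitCircleGraph F27).Adj x' y' := by
    have h := hadj
    simp only [udF27Graph6, SimpleGraph.comap_adj, Function.Embedding.coeFn_mk, ofCoordV_coordV] at h
    exact h
  exact hA hx' hy' (fun h => hxy (by rw [h])) hadj'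

/-- `α(unitCircleGraph F27) ≤ α(udF27Graph6)` (the coordinate map is a graph embedding). -/
theorem indepNum_unitCircleGraph_F27_le_indepNum_udF27Graph6 : (unitCircleGraph F27).indepNum ≤ udF27Graph6.indepNum := by
  classical
  obtain ⟨s, hs⟩ := (unitCircleGraph F27).exists_isNIndepSet_indepNum
  rw [← hs.card_eq]
  have h := (isIndepSet_udF27Graph6_map hs.isIndepSet).card_le_indepNum
  rwa [Finset.card_map] at h

/-- SECOND KERNEL ROUTE to `α(unitCircleGraph F27) ≤ 162` — the statement itself is `indepNum_unitCircleGraph_F27_le` of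
`UnitQuadranceF27Hoffman.lean` (udg g7, 308-entry certificate); here it is the composite of the two lemmas above (not re-declared). -/
example : (unitCircleGraph F27).indepNum ≤ 162 :=
  indepNum_unitCircleGraph_F27_le_indepNum_udF27Graph6.trans indepNum_udF27Graph6_le

end Summit.Ventures.DiscreteObjects.UnitDistance
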